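import Summits.KontsevichZagierPeriods.Zeta5Search.Barrier.ConeGammaShiftLinear

/-!
# ζ(5) search — BARRIER: the slope of the small-shift identity as a finite sum of GERM integrals (P2's `Σ_b K_b`)

HONEST FRAMING (cell `pub-zeta5`): systematic search; no irrationality claim unless kernel-certified. MODEL objects
under Brown–Zudilin's (28)+(30) accounting ([BZ22] = arXiv:2210.03391); nothing here is a statement about `ζ(5)`;
records in print UNMOVED. Complement to `ConeGammaShiftLinear` (item (P4) of `BARRIER-PLAN.md` §2b; theory seat
cert-2 g17, WAKE w3 of lead/lit g23; source: P2 g11 `SE-STRUCTURE.md` §2, Lemma B `P(εs) − P(0) = ε·Σ_b K_b(s)`).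

With `D_η(u) = shiftDiff a δ η u = 𝒩(u·s(a) + ηδ) − 𝒩(u·s(a))` and the sorted breakpoints `b_m = bkpt a T m`:
* `germR a δ η b = ∫₀^W D_η(b + ηw) dw`, `germL a δ η b = ∫_{−W}^0 D_η(b + ηw) dw` — the one-sided GERM INTEGRALS at
  a breakpoint `b` (P2's `K_b` split into its two sides; `W = clusterWidth a δ`);
* **`integral_shiftDiff_cell_eq_germs`** — at ONE scale `ε` (with `εK < 1` and `2εW ≤` the gap):
  `∫_{b_m}^{b_{m+1}} D_ε = ε·(germR ε b_m + germL ε b_{m+1})` (far field + substitution; no Lemma A needed);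
* **`translateIntegral_shift_eq_sum_germs`** — `P(εδ) − P(0) = ε·Σ_{m<M} (germR ε b_m + germL ε b_{m+1})`;
* `germR_scale_free`, `germL_scale_free` — by Lemma A (`shiftDiff_scaling`) the germ integrals do not depend on the
  scale below the radius of `ConeGammaShiftLinear`, so the slope is ONE finite sum of integrals of step functions;
  `germL_period` — the left germ at `b_M = T` is the left germ at `b₀ = 0` (periodicity), so the two half-germs at
  the ends of the period are the two sides of the germ at the torus point `θ = 0`.
Not here (honest): the evaluation of any germ integral (the lane's `J_e`/`dN_g r_g` tables), the cusp coefficient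
`S(t₀;v)` as a named object, any constant or sign — S-E stays CONJECTURED.
-/

noncomputable section

open Set MeasureTheory
open scoped Topology

namespace Summit.KontsevichZagierPeriods.Zeta5Search.Barrier.ConeGamma

/-- The RIGHT germ integral at `b`, scale `η`: `∫₀^W (𝒩((b+ηw)·s(a) + ηδ) − 𝒩((b+ηw)·s(a))) dw`. -/
def germR (a : Dir) (δ : Fin 8 → ℝ) (η b : ℝ) : ℝ :=
  ∫ w in (0 : ℝ)..clusterWidth a δ, shiftDiff a δ η (b + η * w)

/-- The LEFT germ integral at `b`, scale `η`: `∫_{−W}^0 (𝒩((b+ηw)·s(a) + ηδ) − 𝒩((b+ηw)·s(a))) dw`. -/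
def germL (a : Dir) (δ : Fin 8 → ℝ) (η b : ℝ) : ℝ :=
  ∫ w in (-clusterWidth a δ : ℝ)..0, shiftDiff a δ η (b + η * w)

/-- **One cell at one scale**: `∫_{b_m}^{b_{m+1}} D_ε = ε·(germR ε b_m + germL ε b_{m+1})` whenever `εK < 1` and
`2εW ≤ b_{m+1} − b_m` (the middle of the cell is far field; the two ends are rescaled). -/
theorem integral_shiftDiff_cell_eq_germs {a : Dir} (hpos : ∀ k, 0 < h28 a k) {T : ℝ}
    (hper : ∀ k : Fin 28, ∃ z : ℤ, T * h28 a k = z) (δ : Fin 8 → ℝ) {ε : ℝ} (hε : 0 < ε)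
    (h1 : ε * clusterBound a δ < 1) {m : ℕ} (hm : m + 1 < (bkpts a T).card)
    (hgap : 2 * ε * clusterWidth a δ ≤ bkpt a T (m + 1) - bkpt a T m) :
    ∫ u in (bkpt a T m)..(bkpt a T (m + 1)), shiftDiff a δ ε u =
      ε * (germR a δ ε (bkpt a T m) + germL a δ ε (bkpt a T (m + 1))) := by
  have hW := clusterWidth_pos hpos δ
  set L := bkpt a T m with hL
  set R := bkpt a T (m + 1) with hR
  have hLmem : L ∈ bkpts a T := bkpt_mem (by omega)
  have hRmem : R ∈ bkpts a T := bkpt_mem hm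
  have hL0 : 0 ≤ L := (mem_bkpts_bounds hLmem).1
  have hRT : R ≤ T := (mem_bkpts_bounds hRmem).2
  have hYK : shiftSize δ ≤ clusterBound a δ := by
    unfold clusterBound
    have := mul_nonneg hW.le (xMax_pos hpos).le
    linarith
  have hεY : ε * shiftSize δ < 1 :=
    lt_of_le_of_lt (mul_le_mul_of_nonneg_left hYK hε.le) h1
  -- far field in the middle of the cell
  have far : ∀ u ∈ Icc (L + ε * clusterWidth a δ) (R - ε * clusterWidth a δ), shiftDiff a δ ε u = 0 := by
    intro u hu
    unfold shiftDiff
    rw [sub_eq_zero]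
    have hεW : 0 ≤ ε * clusterWidth a δ := mul_nonneg hε.le hW.le
    have hu0 : 0 ≤ u := by linarith [hu.1]
    have huT : u ≤ T := by linarith [hu.2]
    have h := torusN_shift_eq_of_far hpos hper δ hε.le hεY hu0 huT (fun b hb => ?_)
    · exact_mod_cast h
    rcases le_or_gt b L with hbL | hbL
    · rw [abs_of_nonneg (by linarith [hu.1])]
      linarith [hu.1]
    · have hbR : R ≤ b := no_bkpt_between hm hb (by rw [← hL]; exact hbL)
      rw [abs_of_nonpos (by linarith [hu.2])]
      linarith [hu.2]
  have hint := intervalIntegrable_shiftDiff a δ ε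
  -- split the cell into three pieces
  rw [← intervalIntegral.integral_add_adjacent_intervals (hint L (L + ε * clusterWidth a δ))
      (hint (L + ε * clusterWidth a δ) R),
    ← intervalIntegral.integral_add_adjacent_intervals (hint (L + ε * clusterWidth a δ) (R - ε * clusterWidth a δ))
      (hint (R - ε * clusterWidth a δ) R)]
  -- the middle vanishes
  have mid : ∫ u in (L + ε * clusterWidth a δ)..(R - ε * clusterWidth a δ), shiftDiff a δ ε u = 0 := by
    rw [intervalIntegral.integral_congr (g := fun _ => (0 : ℝ)) (fun u hu => ?_)]
    · simp
    · rw [uIcc_of_le (by nlinarith)] at hu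
      exact far u hu
  -- the two ends by substitution `u = b + εw`
  have left : ∫ u in L..(L + ε * clusterWidth a δ), shiftDiff a δ ε u = ε * germR a δ ε L := by
    unfold germR
    have h := intervalIntegral.smul_integral_comp_add_mul (f := shiftDiff a δ ε) (a := 0)
      (b := clusterWidth a δ) ε L
    rw [mul_zero, add_zero, smul_eq_mul] at h
    exact h.symm
  have right : ∫ u in (R - ε * clusterWidth a δ)..R, shiftDiff a δ ε u = ε * germL a δ ε R := by
    unfold germL
    have h := intervalIntegral.smul_integral_comp_add_mul (f := shiftDiff a δ ε) (a := -clusterWidth a δ)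
      (b := 0) ε R
    rw [mul_zero, add_zero, smul_eq_mul, mul_neg, ← sub_eq_add_neg] at h
    exact h.symm
  rw [mid, left, right]
  ring

/-- **The small-shift identity with its slope as a sum of germ integrals** (P2's `P(εs) − P(0) = ε·Σ_b K_b(s)`):
for all 28 forms positive, a period `T`, and a scale `ε` with `εK < 1` and `2εW ≤` every breakpoint gap,
`P(εδ) − P(0) = ε · Σ_{m<M} (germR ε b_m + germL ε b_{m+1})`. -/
theorem translateIntegral_shift_eq_sum_germs {a : Dir} (hpos : ∀ k, 0 < h28 a k) {T : ℝ} (hT : 0 < T)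
    (hper : ∀ k : Fin 28, ∃ z : ℤ, T * h28 a k = z) (δ : Fin 8 → ℝ) {ε : ℝ} (hε : 0 < ε)
    (h1 : ε * clusterBound a δ < 1)
    (hgap : ∀ m, m + 1 < (bkpts a T).card → 2 * ε * clusterWidth a δ ≤ bkpt a T (m + 1) - bkpt a T m) :
    translateIntegral a T (ε • δ) - translateIntegral a T 0 =
      ε * ∑ m ∈ Finset.range ((bkpts a T).card - 1),
        (germR a δ ε (bkpt a T m) + germL a δ ε (bkpt a T (m + 1))) := by
  rw [translateIntegral_sub_eq]
  have hc := two_le_card_bkpts a hT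
  have h := intervalIntegral.sum_integral_adjacent_intervals (a := bkpt a T) (n := (bkpts a T).card - 1)
    (fun m _ => intervalIntegrable_shiftDiff a δ ε _ _)
  rw [bkpt_zero a hT, bkpt_last a hT] at h
  rw [← h, Finset.mul_sum]
  refine Finset.sum_congr rfl fun m hm => ?_
  rw [Finset.mem_range] at hm
  exact integral_shiftDiff_cell_eq_germs hpos hper δ hε h1 (by omega) (hgap m (by omega))

/-- **The germ integrals are scale-free** (Lemma A): for a breakpoint `b` and `0 < ε ≤ ε'` with `ε'K < 1`, `ε'K < d`,
`germR ε b = germR ε' b`. -/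
theorem germR_scale_free {a : Dir} (hpos : ∀ k, 0 < h28 a k) {T b : ℝ} (hb : b ∈ bkpts a T)
    (δ : Fin 8 → ℝ) {ε ε' : ℝ} (hε : 0 < ε) (hεε' : ε ≤ ε')
    (h1 : ε' * clusterBound a δ < 1) (h2 : ε' * clusterBound a δ < wallDist a T) :
    germR a δ ε b = germR a δ ε' b := by
  unfold germR
  refine intervalIntegral.integral_congr fun w hw => ?_
  rw [uIcc_of_le (clusterWidth_pos hpos δ).le] at hw
  have habs : |w| ≤ clusterWidth a δ := by rw [abs_of_nonneg hw.1]; exact hw.2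
  simp only [shiftDiff]
  exact shiftDiff_scaling hpos hb δ hε hεε' habs h1 h2

/-- The left germ integrals are scale-free as well. -/
theorem germL_scale_free {a : Dir} (hpos : ∀ k, 0 < h28 a k) {T b : ℝ} (hb : b ∈ bkpts a T)
    (δ : Fin 8 → ℝ) {ε ε' : ℝ} (hε : 0 < ε) (hεε' : ε ≤ ε')
    (h1 : ε' * clusterBound a δ < 1) (h2 : ε' * clusterBound a δ < wallDist a T) :
    germL a δ ε b = germL a δ ε' b := by
  unfold germL
  refine intervalIntegral.integral_congr fun w hw => ?_
  rw [uIcc_of_le (by linarith [clusterWidth_pos hpos δ])] at hw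
  have habs : |w| ≤ clusterWidth a δ := by rw [abs_of_nonpos hw.2]; linarith [hw.1]
  simp only [shiftDiff]
  exact shiftDiff_scaling hpos hb δ hε hεε' habs h1 h2

/-- **The two ends of the period are one torus point**: the left germ at `b_M = T` equals the left germ at
`b₀ = 0` (periodicity of the orbit), so `germR ε 0 + germL ε T` is the full two-sided germ at `θ = 0`. -/
theorem germL_period {a : Dir} {T : ℝ} (hper : ∀ k : Fin 28, ∃ z : ℤ, T * h28 a k = z) (δ : Fin 8 → ℝ)
    (η : ℝ) : germL a δ η T = germL a δ η 0 := by
  unfold germL shiftDiff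
  refine intervalIntegral.integral_congr fun w _ => ?_
  have hε := (periodic_torusN_line hper (η • δ)) (0 + η * w)
  have h0 := (periodic_torusN_line hper (0 : Fin 8 → ℝ)) (0 + η * w)
  simp only [add_zero] at hε h0
  rw [show T + η * w = 0 + η * w + T by ring, hε, h0]

end Summit.KontsevichZagierPeriods.Zeta5Search.Barrier.ConeGamma

end
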